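import Literature.NumberTheory.EllipticCurves.KodairaNeronAdditiveProofs
import Literature.NumberTheory.EllipticCurves.InertiaInvariantsMultiplicativeProofs
import HarnessLib

/-!
# Silverman *ATAEC* Thm. IV.10.2(a) in full, and the criterion of Néron–Ogg–Shafarevich —
# unconditionally; bsd.S15 from Ogg–Saito at `p = 2, 3` alone

`Proofs` file (theorems only, no definitions, no named facts) in topic
`NumberTheory/EllipticCurves`, landed by the tenured seat of bsd.S15
(`Literature.NumberTheory.EllipticCurves.conductorNorm_eq_artinConductorNat`, `BSDConductor`).
Assembly of the two preceding files of the seat: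

* `InertiaInvariantsMultiplicativeProofs` — the multiplicative case of Thm. IV.10.2(a)
  (`codim (V_ℓ E)^{I_𝔓} = 1`) as a theorem;
* `KodairaNeronAdditiveProofs` — the Kodaira–Néron finiteness over `K_v^nr` at the additive
  places (`kodairaNeron_exists_finset_reducesToNonsingular_of_hasAdditiveReductionAt`), the only
  input of the additive case of Thm. IV.10.2(a)
  (`codimFixed_inertia_rationalTate_eq_two_of_hasAdditiveReductionAt_of_kodairaNeron_additive`).

## Main results (all hypotheses discharged)

* `WeierstrassCurve.codimFixed_inertia_rationalTate_eq_two_of_hasAdditiveReductionAt_holds` — **the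
  named fact `hTa` (Silverman, *Advanced Topics in the Arithmetic of Elliptic Curves*,
  Thm. IV.10.2(a), additive case: `(V_ℓ E)^{I_𝔓} = 0`, i.e. codimension `2`, at a place `v ∤ ℓ` of
  additive reduction; PDF pp. 358–359 of the held copy) is a theorem**;
* `WeierstrassCurve.codimFixed_inertia_rationalTate_eq_tameConductorExponent_holds` — **Thm. IV.10.2(a)
  in full** (`codim (V_ℓ E)^{I_𝔓} = ε_v`, the tame conductor exponent of Tate's algorithm, at every
  place `v ∤ ℓ`);
* `WeierstrassCurve.neronOggShafarevich_holds` — **the criterion of Néron–Ogg–Shafarevich for the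
  Tate module** (Silverman, *AEC*, Thm. VII.7.1 (c) ⇒ (a): `T_ℓ E` unramified at `v ∤ ℓ` implies
  good reduction at `v`), the named fact `WeierstrassCurve.neronOggShafarevich` of
  `NeronOggShafarevich`, by `neronOggShafarevich_of_codimFixed_facts`;
* `WeierstrassCurve.artinConductorExponent_tate_eq_conductorExponent_of_isElliptic_of_ringChar_eq` —
  the C15 fact `a_v(V_ℓ E) = f_v(E)` from **Ogg's formula at `p = 2, 3` alone** (`hW23`), and over
  `ℚ` **bsd.S15** `Literature.NumberTheory.EllipticCurves.conductorNorm_eq_artinConductorNat_of_ringChar_eq`: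
  the schema `conductorNorm_eq_artinConductorNat W ℓ` (`N_E = N^{(ℓ)}(V_ℓ E)`) at an elliptic `W/ℚ`
  from the single named fact
  `swanConductorAt_rationalTate_eq_wildConductorExponent_of_ringChar_eq W ℓ` (Silverman *ATAEC*
  Thm. IV.11.1 at the additive places of residue characteristic `2, 3`: Ogg's case-by-case pages
  366–370 for `p = 3`, Saito for `p = 2` — the one input the book itself does not prove).

So after this file the trust base of bsd.S15 (`conductorNorm_eq_artinConductorNat W ℓ` at an
elliptic `W/ℚ`) is exactly {Ogg–Saito at `p = 2, 3`}; every other ingredient of Silverman's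
Chapter IV §§9–11 route (Tate's algorithm and the local index, Kodaira–Néron over `K^nr`,
Thm. IV.10.2(a),(b)) is a theorem of the tree.

## References

* J. H. Silverman, *Advanced Topics in the Arithmetic of Elliptic Curves*, GTM 151 (1994), §IV.9
  Cor. 9.2(d), 9.4; §IV.10, Thm. 10.2 and its proof (PDF pp. 358–362); §IV.11, Thm. 11.1 and its
  proof (pp. 365–370). [SilvermanATAEC1994]
* J. H. Silverman, *The Arithmetic of Elliptic Curves*, 2nd ed. (2009), Thm. VII.7.1, Cor. VII.6.2.
  [SilvermanAEC2009]
* J.-P. Serre, J. Tate, *Good reduction of abelian varieties*, Ann. of Math. 88 (1968), §1–§3.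
  [SerreTate1968]
* A. P. Ogg, *Elliptic curves and wild ramification*, Amer. J. Math. 89 (1967). [OggAJM1967]

## Design

No definitions; one-line assemblies of theorems of the tree; `noncomputable section`; universe `u`.
-/

noncomputable section

open scoped Classical
open NumberField IsDedekindDomain

universe u

namespace WeierstrassCurve

open Literature.NumberTheory.EllipticCurves Literature.NumberTheory.GaloisRepresentations Field

variable {K : Type u} [Field K] [NumberField K] (W : WeierstrassCurve K) (ℓ : ℕ) [Fact ℓ.Prime]

/-- **The named fact `codimFixed_inertia_rationalTate_eq_two_of_hasAdditiveReductionAt W ℓ`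
(Silverman *ATAEC* Thm. IV.10.2(a), additive case: `codim (V_ℓ E)^{I_𝔓} = 2` at a place `v ∤ ℓ`
of additive reduction) is a theorem**: its reduction to the Kodaira–Néron finiteness over `K_v^nr`
at the additive places (`…_of_kodairaNeron_additive`, `InertiaInvariantsMultiplicativeProofs` /
`InertiaInvariantsKodairaNeronAdditiveProofs`: `V_ℓ(E(K^nr)) ≃ V_ℓ(E₀(K^nr)) ≃ V_ℓ(k̄⁺) = 0`,
PDF p. 359) is fed with `kodairaNeron_exists_finset_reducesToNonsingular_of_hasAdditiveReductionAt`
(`KodairaNeronAdditiveProofs`).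
[cite: SilvermanATAEC1994, Thm. IV.10.2(a), additive case, and its proof (PDF pp. 358–359)] -/
theorem codimFixed_inertia_rationalTate_eq_two_of_hasAdditiveReductionAt_holds :
    W.codimFixed_inertia_rationalTate_eq_two_of_hasAdditiveReductionAt ℓ := by
  intro hE h v hℓ hv 𝔓 h𝔓
  exact W.codimFixed_inertia_rationalTate_eq_two_of_hasAdditiveReductionAt_of_kodairaNeron_additive ℓ
    (fun v' hv' ↦ W.kodairaNeron_exists_finset_reducesToNonsingular_of_hasAdditiveReductionAt hv')
    h v hℓ hv h𝔓

/-- **Silverman *ATAEC* Thm. IV.10.2(a) in full** — the named fact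
`codimFixed_inertia_rationalTate_eq_tameConductorExponent W ℓ`: for an elliptic curve `E/K` over a
number field, a prime `ℓ`, a place `v ∤ ℓ` and a prime `𝔓 ∣ v`, `codim (V_ℓ E)^{I_𝔓} = ε_v`
(`0, 1, 2` at good, multiplicative, additive `v`) — **is a theorem** (good: theorem of
`HasseWeilAbelianConductorProofs`; multiplicative: `InertiaInvariantsMultiplicativeProofs`;
additive: `codimFixed_inertia_rationalTate_eq_two_of_hasAdditiveReductionAt_holds`).
[cite: SilvermanATAEC1994, Thm. IV.10.2(a) (PDF pp. 358–359)] -/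
theorem codimFixed_inertia_rationalTate_eq_tameConductorExponent_holds :
    W.codimFixed_inertia_rationalTate_eq_tameConductorExponent ℓ :=
  W.codimFixed_inertia_rationalTate_eq_tameConductorExponent_of_add ℓ
    (W.codimFixed_inertia_rationalTate_eq_two_of_hasAdditiveReductionAt_holds ℓ)

omit [NumberField K] [Fact ℓ.Prime] in
/-- **The criterion of Néron–Ogg–Shafarevich for the Tate module, unconditionally** — the named
fact `neronOggShafarevich W` of `NeronOggShafarevich` (Silverman, *AEC*, Thm. VII.7.1 (c) ⇒ (a):
for an elliptic curve over a number field and `v ∤ ℓ`, if every inertia group above `v` acts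
trivially on `T_ℓ E` then `E` has good reduction at `v`), from Thm. IV.10.2(a) at the bad places
(`neronOggShafarevich_of_codimFixed_facts`, `NeronOggShafarevichProofs`), both cases of which are now
theorems. [cite: SilvermanAEC2009, Thm. VII.7.1 (c) ⇒ (a)] [cite: SilvermanATAEC1994, Thm. IV.10.2(a)] -/
theorem neronOggShafarevich_holds : W.neronOggShafarevich := by
  intro _ _ v ℓ _ hℓ hunr
  exact W.neronOggShafarevich_of_codimFixed_facts
    (fun ℓ' _ ↦ W.codimFixed_inertia_rationalTate_eq_one_of_hasMultiplicativeReductionAt_holds ℓ')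
    (fun ℓ' _ ↦ W.codimFixed_inertia_rationalTate_eq_two_of_hasAdditiveReductionAt_holds ℓ') v ℓ hℓ
    hunr

/-- **The C15 fact `a_v(V_ℓ E) = f_v(E)` from Ogg–Saito at `p = 2, 3` alone** (the named fact
`swanConductorAt_rationalTate_eq_wildConductorExponent_of_ringChar_eq W ℓ`, Silverman *ATAEC*
Thm. IV.11.1 at the additive places of residue characteristic `2` or `3`): every other input of
`artinConductorExponent_tate_eq_conductorExponent_of_isElliptic_of_add_of_ringChar_eq`
(`InertiaInvariantsMultiplicativeProofs`) is a theorem now.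
[cite: SilvermanATAEC1994, Thm. IV.10.2 and proof of Thm. IV.11.1 (PDF pp. 358–370)] -/
theorem artinConductorExponent_tate_eq_conductorExponent_of_isElliptic_of_ringChar_eq
    (hW23 : W.swanConductorAt_rationalTate_eq_wildConductorExponent_of_ringChar_eq ℓ) :
    W.artinConductorExponent_tate_eq_conductorExponent_of_isElliptic ℓ :=
  W.artinConductorExponent_tate_eq_conductorExponent_of_isElliptic_of_add_of_ringChar_eq ℓ
    (W.codimFixed_inertia_rationalTate_eq_two_of_hasAdditiveReductionAt_holds ℓ) hW23

end WeierstrassCurve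

/-! ### Over `ℚ`: bsd.S15 from Ogg–Saito at `p = 2, 3` alone -/

namespace Literature.NumberTheory.EllipticCurves

open WeierstrassCurve NumberField IsDedekindDomain

variable (W : WeierstrassCurve ℚ) (ℓ : ℕ) [Fact ℓ.Prime]

/-- **bsd.S15 for an elliptic `E/ℚ` from Ogg's formula at `p = 2, 3` alone.**  The schema
`conductorNorm_eq_artinConductorNat W ℓ` — `N_E = N^{(ℓ)}(V_ℓ E)` for `ℓ ∤ N_E`; Silverman *ATAEC*
§IV.10, Definition of the conductor (PDF p. 364), with Thm. IV.10.2 and Ogg's formula IV.11.1 —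
at an elliptic `W/ℚ`, from the single named fact
`swanConductorAt_rationalTate_eq_wildConductorExponent_of_ringChar_eq W ℓ` (Ogg's formula at the
primes of additive reduction of residue characteristic `2, 3`: Ogg 1967 for `p = 3`, the book's
pp. 366–370; Saito 1988 for `p = 2`, to which the book refers, p. 366), by
`conductorNorm_eq_artinConductorNat_of_add_of_ringChar_eq` (`InertiaInvariantsMultiplicativeProofs`)
fed with `codimFixed_inertia_rationalTate_eq_two_of_hasAdditiveReductionAt_holds`.  This is the end
of the decomposition of the fact `conductorNorm_eq_artinConductorNat` (whose schema over all
`W : WeierstrassCurve ℚ` is false at singular `W`, see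
`conductorNorm_eq_artinConductorNat_of_isElliptic`): Tate's algorithm and the local index,
Kodaira–Néron over `ℚ_p^nr`, Thm. IV.10.2(a) and (b) are theorems of the tree; what remains is
Ogg–Saito at `2` and `3`, which the source does not prove either.
[cite: SilvermanATAEC1994, §IV.10 Definition of the conductor (PDF p. 364), Thm. IV.10.2 (p. 358) and Thm. IV.11.1 with its proof (pp. 365–370)] -/
theorem conductorNorm_eq_artinConductorNat_of_ringChar_eq [W.IsElliptic]
    (hW23 : W.swanConductorAt_rationalTate_eq_wildConductorExponent_of_ringChar_eq ℓ) :
    conductorNorm_eq_artinConductorNat W ℓ :=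
  conductorNorm_eq_artinConductorNat_of_add_of_ringChar_eq W ℓ
    (W.codimFixed_inertia_rationalTate_eq_two_of_hasAdditiveReductionAt_holds ℓ) hW23

end Literature.NumberTheory.EllipticCurves

end
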